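import Literature.NumberTheory.GaloisRepresentations.SemilinearLang
import Mathlib.RingTheory.AdicCompletion.Basic
import Mathlib.LinearAlgebra.Matrix.NonsingularInverse
import Mathlib.RingTheory.Ideal.Quotient.Operations
import Mathlib.RingTheory.Jacobson.Ideal
import HarnessLib

/-!
# Lang's theorem over a complete discrete valuation ring with algebraically closed residue field

Let `R` be a commutative ring, `π ∈ R`, `I = (π)` a maximal ideal with `R` `I`-adically complete
and `R ⧸ I` algebraically closed, and `φ : R →+* R` a ring endomorphism fixing `π` and lifting
the `q`-power map of the residue field (`φ x ≡ x ^ q (mod π)`, `q ≥ 2`).  The main example is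
`R = 𝒪̂_{F_nr} = W(k̄) ⊗ 𝒪_F` with `π = ϖ_F` and `φ` an arithmetic Frobenius.  We prove

* `Literature.NumberTheory.GaloisRepresentations.FrobeniusSemilinear.exists_isUnit_det_eq_mul_map`
  — **Lang's theorem for `GL_N`**: for every `G ∈ GL_N(R)` there is `X ∈ GL_N(R)` with
  `X = G · φ(X)` (equivalently `G = X φ(X)⁻¹`: the map `X ↦ X φ(X)⁻¹` is onto, i.e.
  "`H¹(φ^ℤ̂, GL_N(R)) = 1`" / Hilbert 90 for `F̂_nr`).

This is the key input of the `F̂_nr`-admissibility of unramified `p`-adic Galois representations: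
the columns of `X` are a basis of `(F̂_nr ⊗ V)^{Γ_F}` (Fontaine, *Représentations p-adiques des
corps locaux* (1990), A1.2.6; Fontaine–Ouyang, *Theory of p-adic Galois representations*,
Prop. 2.14 / Thm. 2.13; Serre, *Local Fields*, Ch. XIII §5, Lang's theorem for `GL_n`).

## Proof (successive approximation, as formalised)

Modulo `π`: `Y ↦ Ḡ · Ȳ^{(q)}` is an injective `q`-semilinear endomorphism of `k̄^N`
(`k̄ = R ⧸ I`), so by the vector-space form of Lang's theorem
(`FrobeniusSemilinear.exists_basis_forall_apply_eq`, file `SemilinearLang`) `k̄^N` has a basis of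
fixed vectors; the matrix `X̄₀` of these columns is invertible with `X̄₀ = Ḡ X̄₀^{(q)}`; any lift
`X₀` is invertible (`I ⊆ rad R`).  Inductively, if `X_k - G φ(X_k) = π^k C_k`, solve
`Ȳ - Ḡ Ȳ^{(q)} = -C̄_k` in `M_N(k̄)` (additive Lang, `FrobeniusSemilinear.surjective_sub`) and put
`X_{k+1} = X_k + π^k Y`; then `X_{k+1} - G φ(X_{k+1}) ∈ π^{k+1} M_N(R)`.  The `π`-adic limit `X`
(`IsPrecomplete`) satisfies `X - G φ(X) ∈ ⋂ π^k M_N(R) = 0` (`IsHausdorff`) and `X ≡ X₀ (mod π)`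
is invertible.

No definitions besides proof-internal ones; no named facts.

## References

* [SerreLocalFields1979] J.-P. Serre, *Local Fields*, GTM 67, Ch. XIII §5 (Lang's theorem).
* J.-M. Fontaine, *Représentations p-adiques des corps locaux I* (1990), A1.2.6.
* S. Lang, *Algebraic groups over finite fields*, Amer. J. Math. 78 (1956).
-/

noncomputable section

open Module Matrix

namespace Literature.NumberTheory.GaloisRepresentations

namespace FrobeniusSemilinear

universe u

/-! ### Residue-level Lang for matrices -/

section Residue

variable {k : Type u} [Field k] {q : ℕ} {σ : k →+* k}

/-- The `σ`-semilinear endomorphism `v ↦ G · σ(v)` of `kᴺ`. [folklore] -/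
def mulVecSemilinear (σ : k →+* k) {N : ℕ} (G : Matrix (Fin N) (Fin N) k) :
    (Fin N → k) →ₛₗ[σ] (Fin N → k) where
  toFun v := G.mulVec (fun i => σ (v i))
  map_add' v w := by
    have : (fun i => σ ((v + w) i)) = (fun i => σ (v i)) + fun i => σ (w i) := by
      funext i; simp
    rw [this, Matrix.mulVec_add]
  map_smul' c v := by
    have : (fun i => σ ((c • v) i)) = σ c • fun i => σ (v i) := by
      funext i; simp
    rw [this, Matrix.mulVec_smul]

/-- Unfolding lemma for `mulVecSemilinear`. [folklore] -/
@[simp] theorem mulVecSemilinear_apply {N : ℕ} (G : Matrix (Fin N) (Fin N) k) (v : Fin N → k) :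
    mulVecSemilinear σ G v = G.mulVec (fun i => σ (v i)) := rfl

/-- The `σ`-semilinear endomorphism `Y ↦ G · σ(Y)` of `M_N(k)`. [folklore] -/
def mulMapSemilinear (σ : k →+* k) {N : ℕ} (G : Matrix (Fin N) (Fin N) k) :
    Matrix (Fin N) (Fin N) k →ₛₗ[σ] Matrix (Fin N) (Fin N) k where
  toFun Y := G * σ.mapMatrix Y
  map_add' Y Z := by rw [map_add, Matrix.mul_add]
  map_smul' c Y := by
    rw [RingHom.mapMatrix_apply, RingHom.mapMatrix_apply,
      Matrix.map_smul' _ _ _ (map_mul σ), Matrix.mul_smul]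

/-- Unfolding lemma for `mulMapSemilinear`. [folklore] -/
@[simp] theorem mulMapSemilinear_apply {N : ℕ} (G Y : Matrix (Fin N) (Fin N) k) :
    mulMapSemilinear σ G Y = G * σ.mapMatrix Y := rfl

/-- `Y ↦ G σ(Y)` is injective for invertible `G`. [folklore] -/
theorem mulMapSemilinear_injective {N : ℕ} {G : Matrix (Fin N) (Fin N) k} (hG : IsUnit G) :
    Function.Injective (mulMapSemilinear σ G) := by
  refine (injective_iff_map_eq_zero _).2 fun Y hY => ?_
  rw [mulMapSemilinear_apply] at hY
  obtain ⟨u, rfl⟩ := hG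
  have h1 : σ.mapMatrix Y = 0 := by
    have := congrArg (fun Z => (↑u⁻¹ : Matrix (Fin N) (Fin N) k) * Z) hY
    simpa only [← Matrix.mul_assoc, Units.inv_mul, Matrix.one_mul, Matrix.mul_zero] using this
  ext i j
  have hij := congrFun (congrFun h1 i) j
  simp only [RingHom.mapMatrix_apply, Matrix.map_apply, Matrix.zero_apply] at hij
  exact (map_eq_zero_iff σ σ.injective).1 hij

/-- `v ↦ G σ(v)` is injective for invertible `G`. [folklore] -/
theorem mulVecSemilinear_injective {N : ℕ} {G : Matrix (Fin N) (Fin N) k} (hG : IsUnit G) :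
    Function.Injective (mulVecSemilinear σ G) := by
  refine (injective_iff_map_eq_zero _).2 fun v hv => ?_
  rw [mulVecSemilinear_apply] at hv
  have h1 : (fun i => σ (v i)) = 0 :=
    Matrix.mulVec_injective_iff_isUnit.2 hG (by rw [hv, Matrix.mulVec_zero])
  funext i
  exact (map_eq_zero_iff σ σ.injective).1 (congrFun h1 i)

/-- **Residue-level Lang for `GL_N`**: over an algebraically closed field, for `G` invertible and
`σ = (· ^ q)` (`q ≥ 2`) there is an invertible `X` with `X = G σ(X)` (columns: a `σ`-fixed basis).
[cite: SerreLocalFields1979, Ch. XIII §5] -/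
theorem exists_isUnit_eq_mul_map_field [IsAlgClosed k] (hσ : ∀ x, σ x = x ^ q) (hq : 2 ≤ q) {N : ℕ}
    {G : Matrix (Fin N) (Fin N) k} (hG : IsUnit G) :
    ∃ X : Matrix (Fin N) (Fin N) k, IsUnit X ∧ X = G * σ.mapMatrix X := by
  classical
  obtain ⟨b, hb⟩ := exists_basis_forall_apply_eq hσ hq (mulVecSemilinear σ G)
    (mulVecSemilinear_injective hG)
  let e : Fin N ≃ Fin (finrank k (Fin N → k)) := finCongr (Module.finrank_fin_fun k).symm
  let X : Matrix (Fin N) (Fin N) k := Matrix.of fun i j => b (e j) i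
  have hX : ∀ c : Fin N → k, X.mulVec c = ∑ j, c j • (b (e j) : Fin N → k) := by
    intro c
    funext i
    simp only [X, Matrix.mulVec, dotProduct, Matrix.of_apply, Finset.sum_apply, Pi.smul_apply,
      smul_eq_mul]
    exact Finset.sum_congr rfl fun j _ => mul_comm _ _
  refine ⟨X, ?_, ?_⟩
  · rw [← Matrix.mulVec_injective_iff_isUnit]
    intro c c' hcc'
    rw [hX, hX, ← sub_eq_zero, ← Finset.sum_sub_distrib] at hcc'
    have hli : LinearIndependent k (fun j : Fin N => (b (e j) : Fin N → k)) :=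
      b.linearIndependent.comp e e.injective
    have h0 := Fintype.linearIndependent_iff.1 hli (fun j => c j - c' j)
      (by simpa only [sub_smul] using hcc')
    funext j
    exact sub_eq_zero.1 (h0 j)
  · ext i j
    have hfix := congrFun (hb (e j)) i
    rw [mulVecSemilinear_apply] at hfix
    rw [Matrix.mul_apply]
    simp only [X, Matrix.of_apply, RingHom.mapMatrix_apply, Matrix.map_apply]
    rw [← hfix]
    rfl

end Residue

/-! ### Lifting units and congruences -/

section Lift

variable {R : Type u} [CommRing R]

/-- A unit modulo a kernel contained in the Jacobson radical is a unit: if `res : R → k` is a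
surjective ring map whose kernel lies in the Jacobson radical and `res x` is a unit, then `x` is
a unit. [folklore] -/
theorem isUnit_of_isUnit_res {k : Type*} [CommRing k] (res : R →+* k) (hres : Function.Surjective res)
    (hker : RingHom.ker res ≤ (⊥ : Ideal R).jacobson) {x : R} (hx : IsUnit (res x)) : IsUnit x := by
  obtain ⟨y, hy⟩ := hx.exists_right_inv
  obtain ⟨y, rfl⟩ := hres y
  rw [← map_mul, ← map_one res, ← sub_eq_zero, ← map_sub, ← RingHom.mem_ker] at hy
  have h1 : IsUnit (x * y) := by
    have h := Ideal.mem_jacobson_bot.mp (hker hy) 1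
    rwa [mul_one, sub_add_cancel] at h
  exact isUnit_of_mul_isUnit_left h1

/-- A matrix which is invertible modulo such a kernel is invertible. [folklore] -/
theorem isUnit_matrix_of_isUnit_res {k : Type*} [CommRing k] (res : R →+* k)
    (hres : Function.Surjective res) (hker : RingHom.ker res ≤ (⊥ : Ideal R).jacobson) {N : ℕ}
    {X : Matrix (Fin N) (Fin N) R} (hX : IsUnit (res.mapMatrix X)) : IsUnit X := by
  rw [Matrix.isUnit_iff_isUnit_det] at hX ⊢
  rw [← RingHom.map_det] at hX
  exact isUnit_of_isUnit_res res hres hker hX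

/-- Entrywise lifting of matrices along a surjective ring map. [folklore] -/
theorem mapMatrix_surjective {S : Type*} [CommRing S] (f : R →+* S) (hf : Function.Surjective f)
    {N : ℕ} (Y : Matrix (Fin N) (Fin N) S) : ∃ X : Matrix (Fin N) (Fin N) R, f.mapMatrix X = Y := by
  choose g hg using fun i j => hf (Y i j)
  exact ⟨Matrix.of g, by ext i j; simp [hg]⟩

/-- If all entries of `X` lie in the principal ideal `(a)` then `X = a • C`. [folklore] -/
theorem exists_eq_smul_of_forall_mem_span {N : ℕ} (a : R) {X : Matrix (Fin N) (Fin N) R}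
    (hX : ∀ i j, X i j ∈ Ideal.span {a}) : ∃ C : Matrix (Fin N) (Fin N) R, X = a • C := by
  choose c hc using fun i j => Ideal.mem_span_singleton'.1 (hX i j)
  refine ⟨Matrix.of c, ?_⟩
  ext i j
  simp only [Matrix.smul_apply, Matrix.of_apply, smul_eq_mul]
  rw [← hc i j, mul_comm]

end Lift

/-! ### Lang's theorem by successive approximation -/

section Lang

variable {R : Type u} [CommRing R] (π : R) (φ : R →+* R) {q N : ℕ}

/-- The defect `E(X) = X - G φ(X)`. [folklore] -/
def langDefect (G X : Matrix (Fin N) (Fin N) R) : Matrix (Fin N) (Fin N) R :=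
  X - G * φ.mapMatrix X

/-- Unfolding lemma for `langDefect`. [folklore] -/
theorem langDefect_def (G X : Matrix (Fin N) (Fin N) R) : langDefect φ G X = X - G * φ.mapMatrix X := rfl

/-- `φ(a • Y) = a • φ(Y)` when `φ a = a`. [folklore] -/
theorem mapMatrix_smul_of_eq {a : R} (ha : φ a = a) (Y : Matrix (Fin N) (Fin N) R) :
    φ.mapMatrix (a • Y) = a • φ.mapMatrix Y := by
  rw [RingHom.mapMatrix_apply, RingHom.mapMatrix_apply, Matrix.map_smul' _ _ _ (map_mul φ), ha]

/-- The defect of `X + πᵏ Y` is `E(X) + πᵏ (Y - G φ(Y))`. [folklore] -/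
theorem langDefect_add_smul (hπ : φ π = π) (G X Y : Matrix (Fin N) (Fin N) R) (k : ℕ) :
    langDefect φ G (X + π ^ k • Y) = langDefect φ G X + π ^ k • (Y - G * φ.mapMatrix Y) := by
  rw [langDefect_def, langDefect_def, map_add, mapMatrix_smul_of_eq φ (by rw [map_pow, hπ]),
    Matrix.mul_add, Matrix.mul_smul, smul_sub]
  abel

variable [IsAdicComplete (Ideal.span {π}) R]
  {k : Type*} [Field k] [IsAlgClosed k] (res : R →+* k) (σ : k →+* k)

omit [IsAdicComplete (Ideal.span {π}) R] in
/-- **The inductive step**: if `E(X) ∈ πᵏ M_N(R)` then for some `Y`,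
`E(X + πᵏ Y) ∈ πᵏ⁺¹ M_N(R)` — solve `Ȳ - Ḡ Ȳ^{(q)} = -C̄` over the residue field by the additive
Lang theorem.  Here `res : R → k` is the (surjective) residue map with kernel `(π)` onto an
algebraically closed field `k`, and `φ` lifts `σ = (· ^ q)`. [cite: SerreLocalFields1979, Ch. XIII §5] -/
theorem langStep (hres : Function.Surjective res) (hker : ∀ x, res x = 0 ↔ x ∈ Ideal.span {π})
    (hσ : ∀ y, σ y = y ^ q) (hq : 2 ≤ q) (hπ : φ π = π) (hcomp : ∀ x, res (φ x) = σ (res x))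
    {G : Matrix (Fin N) (Fin N) R} (hG : IsUnit G) (X : Matrix (Fin N) (Fin N) R) (k₀ : ℕ)
    (hX : ∀ i j, langDefect φ G X i j ∈ Ideal.span {π ^ k₀}) :
    ∃ Y : Matrix (Fin N) (Fin N) R,
      ∀ i j, langDefect φ G (X + π ^ k₀ • Y) i j ∈ Ideal.span {π ^ (k₀ + 1)} := by
  -- write `E(X) = π ^ k₀ • C` and solve `Ȳ - Ḡ σ(Ȳ) = -C̄`
  obtain ⟨C, hC⟩ := exists_eq_smul_of_forall_mem_span (π ^ k₀) hX
  have hGbar : IsUnit (res.mapMatrix G) := hG.map _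
  obtain ⟨Ybar, hYbar⟩ := surjective_sub hσ hq (mulMapSemilinear σ (res.mapMatrix G))
    (mulMapSemilinear_injective hGbar) (-(res.mapMatrix C))
  obtain ⟨Y, rfl⟩ := mapMatrix_surjective res hres Ybar
  refine ⟨Y, fun i j => ?_⟩
  -- `C + Y - G φ(Y)` vanishes modulo `π`
  have hvan : res.mapMatrix (C + (Y - G * φ.mapMatrix Y)) = 0 := by
    change res.mapMatrix Y - res.mapMatrix G * σ.mapMatrix (res.mapMatrix Y) = -res.mapMatrix C at hYbar
    have hcomp' : σ.mapMatrix (res.mapMatrix Y) = res.mapMatrix (φ.mapMatrix Y) := by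
      ext a b
      simp only [RingHom.mapMatrix_apply, Matrix.map_apply, hcomp]
    rw [hcomp'] at hYbar
    rw [map_add, map_sub, map_mul, hYbar, add_neg_cancel]
  have hentry : (C + (Y - G * φ.mapMatrix Y)) i j ∈ Ideal.span {π} := by
    have := congrFun (congrFun hvan i) j
    simp only [RingHom.mapMatrix_apply, Matrix.map_apply, Matrix.zero_apply] at this
    exact (hker _).1 this
  rw [langDefect_add_smul π φ hπ, hC, ← smul_add, Matrix.smul_apply, smul_eq_mul, pow_succ]
  have h := Ideal.mul_mem_mul (Ideal.mem_span_singleton_self (π ^ k₀)) hentry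
  rwa [Ideal.span_singleton_mul_span_singleton] at h

/-- **Lang's theorem for `GL_N` over a `π`-adically complete ring with algebraically closed
residue field.** Let `π ∈ R` with `R` `(π)`-adically complete, `res : R → k` a surjective ring map
onto an algebraically closed field with kernel `(π)`, and `φ : R → R` a ring endomorphism with
`φ π = π` lifting `σ = (· ^ q) : k → k` (`q ≥ 2`).  Then for every invertible `G ∈ M_N(R)` there is
an invertible `X` with `X = G · φ(X)`.  (Main case: `R = 𝒪̂_{F_nr}`, `π = ϖ_F`, `φ` an arithmetic
Frobenius — Hilbert 90 / `H¹ = 1` for unramified `GL_N`-cocycles over `F̂_nr`.) Serre,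
*Local Fields*, Ch. XIII §5; Fontaine 1990, A1.2.6; Fontaine–Ouyang Prop. 2.14.
[cite: SerreLocalFields1979, Ch. XIII §5] -/
theorem exists_isUnit_eq_mul_map (hres : Function.Surjective res)
    (hker : ∀ x, res x = 0 ↔ x ∈ Ideal.span {π}) (hσ : ∀ y, σ y = y ^ q) (hq : 2 ≤ q)
    (hπ : φ π = π) (hcomp : ∀ x, res (φ x) = σ (res x)) {G : Matrix (Fin N) (Fin N) R}
    (hG : IsUnit G) :
    ∃ X : Matrix (Fin N) (Fin N) R, IsUnit X ∧ X = G * φ.mapMatrix X := by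
  set I := Ideal.span {π} with hI
  have hIjac : I ≤ (⊥ : Ideal R).jacobson := IsAdicComplete.le_jacobson_bot I
  have hkerI : RingHom.ker res ≤ (⊥ : Ideal R).jacobson := by
    intro x hx
    exact hIjac ((hker x).1 hx)
  have hcompM : ∀ Z : Matrix (Fin N) (Fin N) R, σ.mapMatrix (res.mapMatrix Z) = res.mapMatrix (φ.mapMatrix Z) := by
    intro Z
    ext a b
    simp only [RingHom.mapMatrix_apply, Matrix.map_apply, hcomp]
  -- Step 0: an invertible solution modulo `π`
  have hGbar : IsUnit (res.mapMatrix G) := hG.map _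
  obtain ⟨Xbar, hXbar_unit, hXbar⟩ := exists_isUnit_eq_mul_map_field hσ hq hGbar
  obtain ⟨X₀, hX₀⟩ := mapMatrix_surjective res hres Xbar
  -- the successive approximations: `seq n` has defect in `(π ^ (n + 1))`
  let P : ℕ → Matrix (Fin N) (Fin N) R → Prop := fun n Z =>
    ∀ i j, langDefect φ G Z i j ∈ Ideal.span {π ^ (n + 1)}
  have hE₀ : P 0 X₀ := by
    intro i j
    have hvan : res.mapMatrix (langDefect φ G X₀) = 0 := by
      rw [langDefect_def, map_sub, map_mul, ← hcompM, hX₀, ← hXbar, sub_self]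
    have := congrFun (congrFun hvan i) j
    simp only [RingHom.mapMatrix_apply, Matrix.map_apply, Matrix.zero_apply] at this
    rw [zero_add, pow_one]
    exact (hker _).1 this
  have hstep : ∀ n (Z : Matrix (Fin N) (Fin N) R), P n Z →
      ∃ Y : Matrix (Fin N) (Fin N) R, P (n + 1) (Z + π ^ (n + 1) • Y) :=
    fun n Z hZ => langStep π φ res σ hres hker hσ hq hπ hcomp hG Z (n + 1) hZ
  choose Ystep hYstep using hstep
  let seq : ∀ n : ℕ, {Z : Matrix (Fin N) (Fin N) R // P n Z} := fun n =>
    Nat.rec ⟨X₀, hE₀⟩ (fun n Zn => ⟨Zn.1 + π ^ (n + 1) • Ystep n Zn.1 Zn.2, hYstep n Zn.1 Zn.2⟩) n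
  have hseq_succ : ∀ n, (seq (n + 1)).1 = (seq n).1 + π ^ (n + 1) • Ystep n (seq n).1 (seq n).2 :=
    fun n => rfl
  have hseq_zero : (seq 0).1 = X₀ := rfl
  -- entrywise Cauchy
  have hdiff : ∀ n i j, (seq (n + 1)).1 i j - (seq n).1 i j ∈ I ^ (n + 1) := by
    intro n i j
    rw [hseq_succ, Matrix.add_apply, add_sub_cancel_left, Matrix.smul_apply, smul_eq_mul, hI,
      Ideal.span_singleton_pow]
    exact Ideal.mul_mem_right _ _ (Ideal.mem_span_singleton_self _)
  have hcauchy : ∀ i j {m n : ℕ}, m ≤ n →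
      (seq m).1 i j ≡ (seq n).1 i j [SMOD (I ^ m • ⊤ : Submodule R R)] := by
    intro i j m n hmn
    rw [SModEq.sub_mem, smul_eq_mul, Ideal.mul_top]
    induction n, hmn using Nat.le_induction with
    | base => rw [sub_self]; exact zero_mem _
    | succ n hmn ih =>
      have : (seq m).1 i j - (seq (n + 1)).1 i j =
          ((seq m).1 i j - (seq n).1 i j) - ((seq (n + 1)).1 i j - (seq n).1 i j) := by ring
      rw [this]
      exact sub_mem ih (Ideal.pow_le_pow_right (by omega) (hdiff n i j))
  -- the limit
  choose x hx using fun i j => IsPrecomplete.prec' (I := I) (fun n => (seq n).1 i j) (hcauchy i j)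
  let Xl : Matrix (Fin N) (Fin N) R := Matrix.of x
  have hXk : ∀ n i j, Xl i j - (seq n).1 i j ∈ I ^ n := by
    intro n i j
    have := (hx i j n).symm
    rw [SModEq.sub_mem, smul_eq_mul, Ideal.mul_top] at this
    simpa [Xl] using this
  refine ⟨Xl, ?_, ?_⟩
  · -- invertible: `X ≡ X₀ (mod π)`
    refine isUnit_matrix_of_isUnit_res res hres hkerI ?_
    have hXX₀ : res.mapMatrix Xl = Xbar := by
      rw [← hX₀]
      ext i j
      simp only [RingHom.mapMatrix_apply, Matrix.map_apply]
      rw [← sub_eq_zero, ← map_sub, hker, ← hseq_zero]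
      have h1 : Xl i j - (seq 1).1 i j ∈ I := by simpa only [pow_one] using hXk 1 i j
      have h2 : (seq 1).1 i j - (seq 0).1 i j ∈ I := by
        have := hdiff 0 i j
        rwa [Nat.zero_add, pow_one] at this
      have : Xl i j - (seq 0).1 i j = (Xl i j - (seq 1).1 i j) + ((seq 1).1 i j - (seq 0).1 i j) := by
        ring
      rw [this]
      exact add_mem h1 h2
    rw [hXX₀]
    exact hXbar_unit
  · -- `X = G φ(X)`: the defect lies in `⋂ I ^ n = 0`
    rw [← sub_eq_zero]
    change langDefect φ G Xl = 0
    ext i j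
    rw [Matrix.zero_apply]
    refine IsHausdorff.haus' (I := I) _ fun n => ?_
    rw [SModEq.zero, smul_eq_mul, Ideal.mul_top]
    -- `E(X) ≡ E(seq n) ≡ 0 (mod I ^ n)`
    have hφpow : ∀ {y : R}, y ∈ I ^ n → φ y ∈ I ^ n := by
      intro y hy
      rw [hI, Ideal.span_singleton_pow, Ideal.mem_span_singleton] at hy ⊢
      obtain ⟨z, rfl⟩ := hy
      rw [map_mul, map_pow, hπ]
      exact dvd_mul_right _ _
    have hE : langDefect φ G Xl i j - langDefect φ G (seq n).1 i j ∈ I ^ n := by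
      rw [langDefect_def, langDefect_def]
      have : (Xl - G * φ.mapMatrix Xl) i j - ((seq n).1 - G * φ.mapMatrix (seq n).1) i j =
          (Xl - (seq n).1) i j - (G * φ.mapMatrix (Xl - (seq n).1)) i j := by
        simp only [Matrix.sub_apply, map_sub, Matrix.mul_sub]
        ring
      rw [this]
      refine sub_mem (hXk n i j) ?_
      rw [Matrix.mul_apply]
      refine Submodule.sum_mem _ fun l _ => Ideal.mul_mem_left _ _ ?_
      simp only [RingHom.mapMatrix_apply, Matrix.map_apply, Matrix.sub_apply]
      exact hφpow (hXk n l j)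
    have hEk : langDefect φ G (seq n).1 i j ∈ I ^ n := by
      have h := (seq n).2 i j
      rw [← Ideal.span_singleton_pow] at h
      exact Ideal.pow_le_pow_right (Nat.le_succ n) h
    have : langDefect φ G Xl i j = (langDefect φ G Xl i j - langDefect φ G (seq n).1 i j) +
        langDefect φ G (seq n).1 i j := by ring
    rw [this]
    exact add_mem hE hEk

end Lang

end FrobeniusSemilinear

end Literature.NumberTheory.GaloisRepresentations

end
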